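import Summits.SmoothPoincare4.SmoothPoincare4.Theses.SblfDescent

/-!
# Disproof of `RungOne` — findings (cdisprove cycle 1, 2026-08-17)

Crux `stmt-SmoothPoincare4-18531` = `Summit.SmoothPoincare4.SmoothPoincare4.Theses.SblfDescent.RungOne`
(support, rank 9, route `SblfDescent`): for every smooth `M ≃ₕ S⁴`,
HAS(M,0) — a genus-1 simplified broken Lefschetz fibration `f : M → S²` spelled out inline
(orientation `o`, positive Lefschetz set `L`, an indefinite fold chart at every other critical
point, connected non-empty round locus, `f` injective on the critical locus, connected regular
fibres with `H₁ ≅ ℤ²` or `0`, both occurring, Lefschetz values on the genus-1 side) —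
implies `M ≅ S⁴`.

## Findings (all theorems below are sorry-free)

1. **SHIELDED** — `rungOne_of_smoothPoincare4 : SmoothPoincare4 → RungOne`.  Every `M`-instance
   of `RungOne` is an `M`-instance of the summit statement (same binders, same conclusion), so an
   unconditional `¬ RungOne` is an unconditional `¬ SmoothPoincare4` (an exotic 4-sphere that
   moreover carries a genus-1 SBLF).  No counterexample can be exhibited in the tree; none exists
   in print.  This is WHY IT RESISTS.
2. **The SBLF hypothesis is not load-bearing for truth** — `RungOneWithoutSblf` (the crux with
   the whole HAS clause dropped) is literally `SmoothPoincare4` (`rungOneWithoutSblf_iff`), and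
   dropping any sub-clause of HAS gives a statement squeezed between the two
   (`rungOne_of_rungOneWithoutSblf`).  Hence there is NO `_false_without_<H>` lemma for any SBLF
   sub-clause unless SPC4 fails: the negative side of this crux is empty modulo SPC4.
3. **`M ≃ₕ S⁴` is load-bearing** — `RungOneWithoutHomotopyEquiv` is false in print: genus-1
   SBLFs with non-empty round locus and no Lefschetz point live exactly on
   `S⁴, S²×S² # S¹×S³, CP² # CP²bar # S¹×S³, L_n, L'_n` (`π₁ = ℤ/n`, `n > 1`)
   [Baykur–Kamada arXiv:1010.5814 Lemma 11, Thm 13, Cor 14; Hayano arXiv:1012.4049 Thm 4.2 at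
   `r = 0`: `M_{0,l} = S¹×S³ # S`, `M_{1,l} = S⁴`, `M_{n,l} = L_n / L'_n`].  A kernel-checked
   `¬ RungOneWithoutHomotopyEquiv` needs an explicit SBLF-like map on an explicit non-simply-
   connected (or non-compact) 4-manifold with the fold-chart and fibre-homology clauses verified
   (fibre `H₁` via `Literature…nonempty_singularHomology_torus_equiv` /
   `singularHomologyUnitSphereIso`); estimated > 1500 lines, NOT attempted this cycle.  The
   checkable conditional form is `rungOne_false_without_homotopyEquiv_of_witness`.
4. **TIGHTNESS / no slack** — `rungOne_iff_smoothPoincare4_of_forall_has`: if every smooth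
   homotopy 4-sphere carried HAS(·,0), `RungOne ↔ SmoothPoincare4`.  By item 3 + Freedman that
   antecedent is itself equivalent to SPC4, so the rung's content is exactly the printed
   classification — nothing cheaper can prove it, nothing short of ¬SPC4 can refute it.
5. **NOT VACUOUS (on paper)** — HAS(S⁴,0) is realised by the Auroux–Donaldson–Katzarkov broken
   fibration `S⁴ → S²` (one round circle, `L = ∅`, fibres `T²` / `S²`) [ADK 2005 §8.2 Ex. 1;
   Baykur–Kamada Fig. "trivial genus one SBLFs"; Hayano Thm 4.2, case `n = 1, r = 0`].  The
   interface pieces are the tree's honest ones: `singularHomology` is Mathlib's singular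
   homology (so `G y 1` really demands a regular fibre with `H₁ ≅ ℤ²`), `SmoothOrientation`,
   `IsLefschetzCriticalPoint` are the standard Literature definitions.  A formal inhabitant is
   the `h = 0`, `M = S⁴` case of the sibling support `SblfExists` (XL; provers' side).
6. **JUNK-MODEL PROBES of HAS(M,0)** (structural lemmas below): the round locus
   `{p | ¬ R p} \ L` is forced NON-EMPTY (`IsConnected`), so an honest torus fibration / a
   submersion does not qualify (`roundLocus_nonempty_of_has`); `L ⊆` critical locus is forced
   (`IsLefschetzCriticalPoint.mfderiv_eq_zero`, lemma `lefschetz_subset_crit_of_has`); constant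
   `f` violates surjectivity; empty fibres are excluded by surjectivity; fibres over fold values
   are unconstrained (harmless).  No junk satisfies HAS(M,0) short of a genuine broken fibration.
7. **KNOWN IN PRINT modulo the Euler count**: on a homotopy sphere `k = χ − 2 = 0` Lefschetz
   points [Baykur arXiv:1205.5439 p. 8, `χ = 6 − 4g + k`]; at `r = 0` the round 2-handle is
   automatically untwisted (trivial monodromy; Hayano §2.3), so Lemma 11 / Thm 4.2 cover every
   formal instance; `π₁ = 0` leaves `S⁴ = M_{1,l}` only.  Triviality probes: `exact?` fails,
   `simp` / `aesop` exhaust 200k heartbeats (Scratch.lean, 2026-08-17).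

8. **TARGETS (line `Sketch`, 6 registered stubs)** — all attacked, none broken; see the
   `Targets` section at the end (per-stub argument, kernel-checked arithmetic for
   `stub_baseFunction`, and a caveat on the apex `stub_twoCrit`: algebraic vs geometric
   intersection one in the level `S¹×S² # S¹×S²`).
9. **TREE STATE used**: `RungOne ⇐ A ∧ B` is kernel-checked
   (`Theorems/SblfDescentRungOne.RungOne_of_eulerCount_of_noLefschetz`), `A` (Euler count) is
   discharged, so the crux's open content is exactly fact `B`
   (`nonempty_diffeomorph_sphere_four_of_sblf_genus_one_noLefschetz`, BK Lemma 11 + Cor 14);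
   the route's inline HAS(M,0) is `∃ o f L, IsSimplifiedBrokenLefschetzFibration o f L 0`
   (`sblfDescent_has_zero_iff`).

## For the provers
The proof obligations are (i) `L = ∅` from `M ≃ₕ S⁴` (χ-additivity over higher side / round
cobordism / lower side), (ii) the handlebody `T²×D² ∪ round 2-handle ∪ S²×D²` of an `r = 0`
genus-1 SBLF and its five diffeomorphism types, (iii) `π₁ = 0 ⇒ n = 1 ⇒ S⁴`.  Nothing on the
negative side constrains you further: every sub-clause of HAS may be used or ignored.
-/

noncomputable section

open scoped Manifold ContDiff Topology ContinuousMap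

namespace Summit.SmoothPoincare4.SmoothPoincare4.Cruxes.RungOne.Disproof

open Summit.SmoothPoincare4.SmoothPoincare4.Theses.SblfDescent

set_option linter.dupNamespace false

/-- **HAS(M,0)** — the hypothesis of `RungOne`, verbatim (the `∃ o f L, …` clause at lower
genus `0`): `M` carries a genus-1 simplified broken Lefschetz fibration over `S²`. -/
def HasGenusOneSblf (M : Type) [TopologicalSpace M] [ChartedSpace (EuclideanSpace ℝ (Fin 4)) M]
    [IsManifold (𝓡 4) ((⊤ : ℕ∞) : WithTop ℕ∞) M] : Prop :=
  ∃ (o : Literature.Topology.FourManifolds.SmoothOrientation (𝓡 4) M)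
    (f : M → (Metric.sphere (0 : EuclideanSpace ℝ (Fin 3)) 1)) (L : Finset M),
    let R : M → Prop := fun q => Function.Surjective (mfderiv (𝓡 4) (𝓡 2) f q)
    let G : (Metric.sphere (0 : EuclideanSpace ℝ (Fin 3)) 1) → ℕ → Prop := fun y n =>
      Nonempty ((Fin (2 * n) → ℤ) ≃ₗ[ℤ]
        Literature.AlgebraicTopology.SingularHomology.singularHomology ℤ ℤ ↥(f ⁻¹' {y}) 1)
    ContMDiff (𝓡 4) (𝓡 2) ((⊤ : ℕ∞) : WithTop ℕ∞) f ∧ Function.Surjective f ∧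
    (∀ p ∈ L, Literature.Topology.FourManifolds.IsLefschetzCriticalPoint (𝓡 4) (𝓡 2) o f p true) ∧
    (∀ p : M, ¬ R p → p ∉ L → ∃ (φ : OpenPartialHomeomorph M (EuclideanSpace ℝ (Fin 4)))
      (ψ : OpenPartialHomeomorph (Metric.sphere (0 : EuclideanSpace ℝ (Fin 3)) 1)
        (EuclideanSpace ℝ (Fin 2))),
      p ∈ φ.source ∧ φ p = 0 ∧ Set.MapsTo f φ.source ψ.source ∧
      ContMDiffOn (𝓡 4) (𝓡 4) ((⊤ : ℕ∞) : WithTop ℕ∞) φ φ.source ∧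
      ContMDiffOn (𝓡 4) (𝓡 4) ((⊤ : ℕ∞) : WithTop ℕ∞) φ.symm φ.target ∧
      ContMDiffOn (𝓡 2) (𝓡 2) ((⊤ : ℕ∞) : WithTop ℕ∞) ψ ψ.source ∧
      ContMDiffOn (𝓡 2) (𝓡 2) ((⊤ : ℕ∞) : WithTop ℕ∞) ψ.symm ψ.target ∧
      ∀ q ∈ φ.source, (ψ (f q)) 0 = (φ q) 0 ∧
        (ψ (f q)) 1 = (φ q) 1 ^ 2 + (φ q) 2 ^ 2 - (φ q) 3 ^ 2) ∧
    IsConnected ({p : M | ¬ R p} \ (↑L : Set M)) ∧ Set.InjOn f {p : M | ¬ R p} ∧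
    (∀ y, (∀ q, f q = y → R q) → IsConnected (f ⁻¹' {y}) ∧ (G y (0 + 1) ∨ G y (0))) ∧
    (∃ y, (∀ q, f q = y → R q) ∧ G y (0 + 1)) ∧ (∃ y, (∀ q, f q = y → R q) ∧ G y (0)) ∧
    (∀ p ∈ L, ∀ᶠ y in nhds (f p), (∀ q, f q = y → R q) → G y (0 + 1))

/-- `RungOne` unfolds to "`M ≃ₕ S⁴ → HAS(M,0) → M ≅ S⁴`" (definitional; records that
`HasGenusOneSblf` is a verbatim copy of the crux hypothesis). -/
theorem rungOne_iff :
    RungOne ↔ ∀ (M : Type) [TopologicalSpace M] [T2Space M] [SecondCountableTopology M]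
      [ChartedSpace (EuclideanSpace ℝ (Fin 4)) M] [IsManifold (𝓡 4) ((⊤ : ℕ∞) : WithTop ℕ∞) M],
      M ≃ₕ (Metric.sphere (0 : EuclideanSpace ℝ (Fin 5)) 1) → HasGenusOneSblf M →
        Nonempty (Diffeomorph (𝓡 4) (𝓡 4) M (Metric.sphere (0 : EuclideanSpace ℝ (Fin 5)) 1) ((⊤ : ℕ∞) : WithTop ℕ∞)) :=
  Iff.rfl

/-! ### 1. Shield: the crux is implied by the summit statement -/

/-- **SHIELD.** `SmoothPoincare4 → RungOne`: the crux is a weakening of the summit statement,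
so any unconditional refutation of `RungOne` refutes SPC4.  (This is the whole reason the
crux resists disproof.) -/
theorem rungOne_of_smoothPoincare4 (h : _root_.SmoothPoincare4) : RungOne := by
  intro M _ _ _ _ _ e _
  exact h M ‹_› ‹_› e

/-! ### 2. Dropping the SBLF hypothesis: not load-bearing (modulo SPC4) -/

/-- `RungOne` with the entire HAS(M,0) hypothesis DROPPED. -/
def RungOneWithoutSblf : Prop :=
  ∀ (M : Type) [TopologicalSpace M] [T2Space M] [SecondCountableTopology M]
    [ChartedSpace (EuclideanSpace ℝ (Fin 4)) M] [IsManifold (𝓡 4) ((⊤ : ℕ∞) : WithTop ℕ∞) M],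
    M ≃ₕ (Metric.sphere (0 : EuclideanSpace ℝ (Fin 5)) 1) → Nonempty (Diffeomorph (𝓡 4) (𝓡 4) M (Metric.sphere (0 : EuclideanSpace ℝ (Fin 5)) 1) ((⊤ : ℕ∞) : WithTop ℕ∞))

/-- Dropping the SBLF hypothesis gives back the summit statement VERBATIM: so no sub-clause of
HAS(M,0) can carry a `_false_without_` lemma unless `¬ SmoothPoincare4`. -/
theorem rungOneWithoutSblf_iff : RungOneWithoutSblf ↔ _root_.SmoothPoincare4 := by
  constructor
  · intro h M _ _ _ _ _ e
    exact h M e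
  · intro h M _ _ _ _ _ e
    exact h M ‹_› ‹_› e

/-- … and every weakening of the hypothesis lands between `RungOne` and `SmoothPoincare4`. -/
theorem rungOne_of_rungOneWithoutSblf (h : RungOneWithoutSblf) : RungOne :=
  rungOne_of_smoothPoincare4 (rungOneWithoutSblf_iff.mp h)

/-! ### 3. Dropping `M ≃ₕ S⁴`: load-bearing (witnesses in print, none constructible cheaply) -/

/-- `RungOne` with the homotopy-equivalence hypothesis DROPPED: "every smooth 4-manifold with a
genus-1 SBLF is `S⁴`".  FALSE in print — `S²×S² # S¹×S³`, `CP² # CP²bar # S¹×S³`, Pao's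
`L_n`, `L'_n` (`π₁ = ℤ/n`) carry genus-1 SBLFs without Lefschetz points [Baykur–Kamada
arXiv:1010.5814 Lemma 11 / Cor 14; Hayano arXiv:1012.4049 Thm 4.2].  OPEN NEGATIVE TARGET:
a kernel-checked `¬ RungOneWithoutHomotopyEquiv` needs such a fibration built in Lean
(see `rungOne_false_without_homotopyEquiv_of_witness` for the exact obligation). -/
def RungOneWithoutHomotopyEquiv : Prop :=
  ∀ (M : Type) [TopologicalSpace M] [T2Space M] [SecondCountableTopology M]
    [ChartedSpace (EuclideanSpace ℝ (Fin 4)) M] [IsManifold (𝓡 4) ((⊤ : ℕ∞) : WithTop ℕ∞) M],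
    HasGenusOneSblf M → Nonempty (Diffeomorph (𝓡 4) (𝓡 4) M (Metric.sphere (0 : EuclideanSpace ℝ (Fin 5)) 1) ((⊤ : ℕ∞) : WithTop ℕ∞))

/-- The homotopy-equivalence-free version implies the crux (it is a strengthening). -/
theorem rungOne_of_rungOneWithoutHomotopyEquiv (h : RungOneWithoutHomotopyEquiv) : RungOne := by
  intro M _ _ _ _ _ _ hM
  exact h M hM

/-- **Exact obligation for `rungOne_false_without_homotopyEquiv`.**  Any smooth 4-manifold `W`
with HAS(W,0) that is not diffeomorphic to `S⁴` kills the homotopy-equivalence-free version;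
in print `W = S²×S² # S¹×S³` with the ADK-type fibration (or `L_2`) does it, and so does any
NON-COMPACT `W` with HAS(W,0) (then `IsEmpty (W ≃ₘ S⁴)` is free, `S⁴` being compact). -/
theorem rungOne_false_without_homotopyEquiv_of_witness (W : Type) [TopologicalSpace W]
    [T2Space W] [SecondCountableTopology W] [ChartedSpace (EuclideanSpace ℝ (Fin 4)) W]
    [IsManifold (𝓡 4) ((⊤ : ℕ∞) : WithTop ℕ∞) W] (hW : HasGenusOneSblf W)
    (hne : IsEmpty (Diffeomorph (𝓡 4) (𝓡 4) W (Metric.sphere (0 : EuclideanSpace ℝ (Fin 5)) 1) ((⊤ : ℕ∞) : WithTop ℕ∞))) :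
    ¬ RungOneWithoutHomotopyEquiv := fun h =>
  hne.elim (h W hW).some

/-- Non-compact witnesses suffice: a non-compact `W` is never diffeomorphic to `S⁴`. -/
theorem isEmpty_diffeomorph_sphere_of_not_compactSpace (W : Type) [TopologicalSpace W]
    [ChartedSpace (EuclideanSpace ℝ (Fin 4)) W] (hW : ¬ CompactSpace W) :
    IsEmpty (Diffeomorph (𝓡 4) (𝓡 4) W (Metric.sphere (0 : EuclideanSpace ℝ (Fin 5)) 1) ((⊤ : ℕ∞) : WithTop ℕ∞)) := by
  refine ⟨fun e => hW ?_⟩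
  exact e.toHomeomorph.symm.compactSpace

/-! ### 4. Tightness: universal existence would make the rung equal to SPC4 -/

/-- **No slack.**  If every smooth homotopy 4-sphere carried a genus-1 SBLF, the rung would BE
the summit.  (By Baykur–Kamada Lemma 11 + Freedman the antecedent is itself equivalent to
SPC4, so the rung's content is exactly the printed classification theorem.) -/
theorem rungOne_iff_smoothPoincare4_of_forall_has
    (hex : ∀ (M : Type) [TopologicalSpace M] [T2Space M] [SecondCountableTopology M]
      [ChartedSpace (EuclideanSpace ℝ (Fin 4)) M] [IsManifold (𝓡 4) ((⊤ : ℕ∞) : WithTop ℕ∞) M],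
      M ≃ₕ (Metric.sphere (0 : EuclideanSpace ℝ (Fin 5)) 1) → HasGenusOneSblf M) :
    RungOne ↔ _root_.SmoothPoincare4 := by
  refine ⟨fun h M _ _ _ _ _ e => ?_, rungOne_of_smoothPoincare4⟩
  exact h M e (hex M e)

/-! ### 6. Junk-model probes: what HAS(M,0) forces structurally -/

/-- The round (fold) locus of HAS(M,0) is NON-EMPTY: an honest genus-1 Lefschetz fibration or
torus bundle over `S²` (empty round locus), or a submersion, does not satisfy the hypothesis.
(So the junk model "`f` a submersion / a bundle projection" is excluded by `IsConnected`.) -/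
theorem roundLocus_nonempty_of_has {M : Type} [TopologicalSpace M]
    [ChartedSpace (EuclideanSpace ℝ (Fin 4)) M] [IsManifold (𝓡 4) ((⊤ : ℕ∞) : WithTop ℕ∞) M]
    (h : HasGenusOneSblf M) :
    ∃ (f : M → (Metric.sphere (0 : EuclideanSpace ℝ (Fin 3)) 1)) (L : Finset M),
      ({p : M | ¬ Function.Surjective (mfderiv (𝓡 4) (𝓡 2) f p)} \ (↑L : Set M)).Nonempty := by
  obtain ⟨_, f, L, _, _, _, _, hconn, _⟩ := h
  exact ⟨f, L, hconn.nonempty⟩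

/-- The Lefschetz set `L` of HAS(M,0) lies in the critical locus (`dπ_p = 0` at a Lefschetz
point): `L` cannot be padded with regular points. -/
theorem lefschetz_subset_crit_of_has {M : Type} [TopologicalSpace M]
    [ChartedSpace (EuclideanSpace ℝ (Fin 4)) M] [IsManifold (𝓡 4) ((⊤ : ℕ∞) : WithTop ℕ∞) M]
    (h : HasGenusOneSblf M) :
    ∃ (f : M → (Metric.sphere (0 : EuclideanSpace ℝ (Fin 3)) 1)) (L : Finset M),
      Function.Surjective f ∧
      ∀ p ∈ L, ¬ Function.Surjective (mfderiv (𝓡 4) (𝓡 2) f p) := by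
  obtain ⟨o, f, L, _, hsurj, hL, _⟩ := h
  refine ⟨f, L, hsurj, fun p hp hp' => ?_⟩
  have h0 := (hL p hp).mfderiv_eq_zero
  rw [h0] at hp'
  obtain ⟨v, hv⟩ := hp' (EuclideanSpace.single 0 1)
  have hy : EuclideanSpace.single (0 : Fin 2) (1 : ℝ) = 0 := by rw [← hv]; rfl
  have h1 := congrArg (fun w : EuclideanSpace ℝ (Fin 2) => w 0) hy
  simp at h1

/-! ### Targets — the six stubs of the picked line `Sketch` (registered 2026-08-17T14:42Z)

Line `Cruxes/RungOne/Lines/Sketch.lean` (lead `prover-line-stmt-SmoothPoincare4-18531-0`):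
one Morse function with six critical points, two Milnor cancellations, twisted sphere, Cerf.
Attack log (cycle 1; every stub ATTACKED, none broken — all are true in print / by calculus):

* `stub_angularSubmersion` — TRUE.  At a round point `q`, `f q = (a, b, 0)`; the fold chart
  gives `rank df_q = 1` with image the tangent line of the critical image, which is the equator
  (hypothesis `f '' round = sphereEquator 1`), spanned by `(-b, a, 0)`; and
  `d(-b y₀ + a y₁)(-b, a, 0) = a² + b² = 1 ≠ 0`.  No degenerate case (`(a, b) ≠ 0` on the equator).
* `stub_baseFunction` — TRUE, checked by Lagrange multipliers AND numerically (pure-python grid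
  scan of the Riemannian gradient on `S²`, 1441 × 1241 points: exactly two near-critical clusters
  `(±0.974, 0, -0.225)`): `∇ℓ = (1 - s/4, 0, -y₀/4) ∥ y` forces `y₁ = 0`, `y₀ ≠ 0` and
  `2s² - 4s - 1 = 0`, `s = ⟪y, v⟫ = 1 - √6/2 ≈ -0.2247 < 0` (kernel-checked:
  `baseFunction_criticalLatitude_eq`, `…_neg`), so BOTH critical points lie in the sphere-side
  hemisphere `⟪·, v⟫ < 0`, on `y₁ = 0`, with `y₀ = ∓0.9744`; values `∓1.029166`
  (kernel-checked: `baseFunction_criticalValue_gt_one`, so `ℓ m < -1`, `1 < ℓ M` are right and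
  not off-by-a-constant); numerical Hessians `diag(∓1.084, ∓1.193)` — nondegenerate, indices
  `0` / `2`.  (For `v = (0,0,-1)` the picture is mirrored, same conclusions.)
* `stub_roundCriticalPoints` — TRUE.  `d(ℓ ∘ f)_q = dℓ ∘ df_q` vanishes iff `dℓ(-b, a, 0) = 0`;
  on the equator `s = 0` and `ds(-b,a,0) = 0`, so this is `d y₀ (-b, a, 0) = -b = 0`, i.e.
  `(f q)₁ = 0`.  In the fold chart `ℓ ∘ f = h(t, Q)`, `Q = x₁² + x₂² - x₃²`, Hessian
  `diag(h_tt, 2h_Q, 2h_Q, -2h_Q)`; the side `Q > 0` is NECESSARILY the torus side (crossing the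
  fold towards `Q > 0` joins two discs of the fibre by a tube, raising the genus), so
  `sign h_Q = sign ∂ℓ/∂s = sign(-y₀/4)`: over `(1,0,0)` `h_Q < 0`, `h_tt < 0` (max of
  `ℓ|equator = y₀`) ⇒ index `3`; over `(-1,0,0)` `h_Q > 0`, `h_tt > 0` ⇒ index `1` — exactly the
  stub's `if 0 < (f q)₀ then 3 else 1`.  Nondegeneracy: `∂ℓ/∂s = ∓1/4 ≠ 0` and
  `(y₀ ∘ equator)'' = -θ'² ≠ 0`.
* `stub_sixCrit` — TRUE (existential in `μ, r, ε, ρ`): off `range ι` the only critical points of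
  `ℓ ∘ f` are the two round points over `(±1,0,0)` (torus side: `df` onto and `dℓ ≠ 0` there,
  since `m, M` are on the sphere side; round points: previous stub; uniqueness of `q∓` from
  `InjOn f crit`); on the plateaus `ρ = 1` the function is the product `L(w) + ε μ(x)` with the
  four critical points `(x∓, w_m)`, `(x∓, w_M)` of indices `0+0, 0+2, 2+0, 2+2`; on the annuli
  `r/2 < dist < r`, `|dL|` is bounded below (no critical point of `L` there as `2r < dist w_m w_M`)
  so `ε` small kills all critical points; the support of the perturbation is the compact
  `ι(S² × closed r-balls) ⊂ range ι` (open), so `G` is smooth; `G q₋ = ℓ(-1,0,0) = -1`,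
  `G q₊ = 1` exactly, and the value chain holds for `ε < (|ℓ m| - 1)/max|μ|`.
* `stub_twoCrit` (apex) — TRUE AS A STATEMENT but it is `B` in costume-strength: its conclusion
  (a Morse function with exactly two critical points on `X`) does not mention the data, so the
  stub says "hypotheses satisfiable ⇒ `X` admits a 2-point Morse function", and the hypotheses
  (closed, simply connected, genus-1 Lefschetz-free SBLF) give `X ≅ S⁴` by Baykur–Kamada
  Lemma 11 + Cor 14 — hence the conclusion (height function).  So it cannot be refuted short of
  refuting the printed classification; conversely it is not weaker than `B` modulo Cerf + Reeb
  (both in the tree).  CAVEAT for the lead (not a refutation): the docstring's route to it —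
  literal Milnor cancellation of `(2_m, 3)` and `(1, 2_M)` — needs GEOMETRIC intersection one of
  the ascending circle / descending sphere in the level `Y_c ≅ S¹×S² # S¹×S²` (`c ∈ (-1, 1)`:
  `Y_c` fibres over the level circle of `ℓ` with fibres `S², T², S²` and two fold crossings whose
  vanishing cycles are isotopic, trivial monodromy), while "`π₁(X) = 1` forces winding `±1`"
  (Baykur–Kamada's `n = 1`) is an ALGEBRAIC statement; the step algebraic ⇒ geometric is a
  knot-in-`S¹×S²` isotopy question that the printed proofs settle by Kirby calculus
  (Hayano Fig. 14–16, `M_{1,l} = S⁴`), not by general position.  Dropping `[SimplyConnectedSpace X]`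
  makes the stub false in print (`L_n`, `n ≥ 2`; `S¹×S³ # S²×S²`), so that hypothesis is
  load-bearing and must be consumed exactly at this step.
* `stub_cerf` — the named fact `cerf_twistedSphere_four` (Cerf 1968, `Γ₄ = 0`); external debt
  with its own crux seat (`SchsplitCerf`); true in print.

Joint sufficiency: `noLefschetz_of_stubs` / `RungOne_of` in the skeleton compose the six stubs
into the crux BY NAME and elaborate on the farm — no gap to exploit.  Verdict: 6 targets,
0 broken; the line is sound, its whole difficulty sits in `stub_twoCrit` (+ Cerf).
-/

/-- `stub_baseFunction` sanity (1/3): the critical latitude `s = 1 - √6/2` of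
`ℓ = y₀ (1 - s/4)` on `S²` solves the Lagrange equation `2s² - 4s - 1 = 0`. -/
theorem baseFunction_criticalLatitude_eq :
    2 * (1 - Real.sqrt 6 / 2) ^ 2 - 4 * (1 - Real.sqrt 6 / 2) - 1 = 0 := by
  have h : Real.sqrt 6 ^ 2 = 6 := Real.sq_sqrt (by norm_num)
  nlinarith [h]

/-- `stub_baseFunction` sanity (2/3): the critical latitude is negative, i.e. both critical
points of `ℓ` lie in the hemisphere `⟪·, v⟫ < 0` (the sphere side), as the stub claims. -/
theorem baseFunction_criticalLatitude_neg : 1 - Real.sqrt 6 / 2 < 0 := by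
  have : (2 : ℝ) < Real.sqrt 6 := (Real.lt_sqrt (by norm_num)).mpr (by norm_num)
  linarith

/-- `stub_baseFunction` sanity (3/3): the critical value `ℓ M = √(1 - s²) (1 - s/4)` exceeds
`1` (numerically `1.029166`), so the clauses `1 < ℓ M` and (by `y₀ ↦ -y₀`) `ℓ m < -1` hold. -/
theorem baseFunction_criticalValue_gt_one :
    1 < Real.sqrt (1 - (1 - Real.sqrt 6 / 2) ^ 2) * (1 - (1 - Real.sqrt 6 / 2) / 4) := by
  have hrlo : (2.449 : ℝ) < Real.sqrt 6 := (Real.lt_sqrt (by norm_num)).mpr (by norm_num)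
  have hrhi : Real.sqrt 6 < (2.4495 : ℝ) := (Real.sqrt_lt' (by norm_num)).mpr (by norm_num)
  set s : ℝ := 1 - Real.sqrt 6 / 2 with hs
  have hs1 : -0.22475 < s := by rw [hs]; linarith
  have hs2 : s < -0.2245 := by rw [hs]; linarith
  have hsq : 0.974 < Real.sqrt (1 - s ^ 2) := by
    apply (Real.lt_sqrt (by norm_num)).mpr
    nlinarith [mul_pos (sub_pos.mpr hs1) (sub_pos.mpr hs2)]
  have hfac : (1.056 : ℝ) < 1 - s / 4 := by linarith
  calc (1 : ℝ) < 0.974 * 1.056 := by norm_num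
    _ < Real.sqrt (1 - s ^ 2) * (1 - s / 4) := mul_lt_mul'' hsq hfac (by norm_num) (by norm_num)

/-! ### Targets, addendum — line `Sketch` RESHAPED by the lead (tree file 2026-08-17T15:17Z)

Main composition is now Cerf-free and LP-free: `noLefschetz_of_stubs` uses `stub_angularSubmersion`,
`stub_torusLoops` (named fact `gramain_loopHomotopy_translationLoop_torus`, Earle–Eells 1969 /
Gramain 1973), `stub_sliceRecognition`, `stub_sliceGluing` (apex); the Morse stubs 2–4 survive
only in the variant `noLefschetz_of_morseEndgame` (with the old apex as hypothesis `hTwoCrit`).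
The reshaped skeleton elaborates (farm rc 0, 7 sorries = the stubs).  Attack of the new stubs:

* `stub_torusLoops` — TRUE in print: evaluation `Diff₀(T²) → T²` is a homotopy equivalence with
  the translations as a section (Earle–Eells), so a based loop `γ_t` and the translation loop
  `τ_t` with the same evaluation path differ by the loop `τ_t⁻¹ ∘ γ_t` in the fibre
  `Diff₀(T²) ∩ Diff(T², x₀)`, which is contractible (LES of the evaluation fibration) — hence the
  deformation THROUGH loops with the same evaluation path exists, as the fact states.
* `stub_sliceRecognition` — TRUE, and with no hidden case: a slice-preserving gluing map is
  `φ(y, w) = (g_w y, w)`, `g : S¹ → Diff(S²) ≃ O(3)` (Smale); `π₁ SO(3) = ℤ/2` gives TWO classes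
  of loops, but BOTH straightened loops `w ↦ A_w L` extend linearly over `V₀ ≅ B³ × S¹`, so
  `X ≅ W₀ ∪_{id} V₀ = S⁴` either way (the Gluck-twist ambiguity is invisible for the unknotted
  sphere).  Nothing to refute.
* `stub_sliceGluing` (apex) — TRUE AS A STATEMENT (again `B`-strength: given `B`, `X ≅ S⁴ =
  W₀ ∪_{id} V₀`, and `IsBoundaryGluing` transports along the diffeomorphism), irrefutable short
  of refuting Baykur–Kamada Lemma 11; `[SimplyConnectedSpace X]` load-bearing (`L_n`, `n ≥ 2`,
  and `S¹×S³ # S²×S²` carry all the other hypotheses).  The "degree `±1` from `π₁(X) = 1`" step is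
  now consumed by loop-straightening (Gramain) instead of an intersection count, which removes the
  algebraic-vs-geometric caveat raised above for `stub_twoCrit`; the residual risk is purely formal
  (S¹-parametric fold normal form, untwistedness of the round handle: a twisted one would give
  torus monodromy `-id ∉ Diff₀`, correctly excluded in the docstring).

Verdict after the reshape: 4 live targets + 3 variant stubs, 0 broken.
-/

end Summit.SmoothPoincare4.SmoothPoincare4.Cruxes.RungOne.Disproof

end
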